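import Summits.BirchSwinnertonDyer.BirchSwinnertonDyer.Theorems.GenusKolyvaginAtTwoPowDvdShaCardAtTwoRTEigenIndexTwoKolyvaginPrime
import Summits.BirchSwinnertonDyer.BirchSwinnertonDyer.Theorems.GenusKolyvaginAtTwoPowDvdShaCardAtTwoRTPrimeSwappingWeakLevel
import HarnessLib

/-!
# Route `GenusKolyvaginAtTwo`, crux L_T `PowDvdShaCardAtTwoRT` (stmt-BirchSwinnertonDyer-23242), LINE 18 `plus_descent` v5.2,
# stub KS — THE WEAK PRIME-SWAPPING LOOP AT `p = 2` OVER `K` ON `τ`-EIGEN SELMER CLASSES, formal inputs discharged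

Seat `bsd-line-gk2-p5` g23 (WIDTH-5 attach, cell `bsd-f1-sign2`), `--supports stmt-BirchSwinnertonDyer-23242` (helper; it closes
nothing, and BSD is not proved by it).

WHY.  gk2-p2's loop with exported level `exists_level_avoiding_of_weakSwapOracle_pow` (`…RTPrimeSwappingWeakLevel`, p711486) is
Mathlib-only algebra over an abstract `p^M`-torsion group `V`, a finite `R ≤ V`, strict conditions `A l`, a predicate `good`, and
displays `hK` (index `∣ p` of `A l` on `⟨s⟩[p]`, `s ⊆ R`).  For the DROPS of stub KS the instantiation is forced by the KS clause
(`…/Cruxes/PowDvdShaCardAtTwoRT/Lines/plus_descent.lean`, `stub_kolyvaginSystemAtTwo`; gk2-p2 g18 HANDOFF «INTERFACE NOTE»):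
`V = H¹(K, E[2^L])`, `p = 2`, the classes to avoid are `≤ 2m+1` SELMER classes `u_j` with `τ_* u_j = ε u_j` (plus, at even depth, the
seed `c_L(1)`), `A ℓ = ⨅_{v ∋ ℓ} ker (H¹(K,E[2^L]) → H¹(K_v,E[2^L]))` (the separation currency of
`avoidance_of_kolyvaginSupply_of_separation_intrinsic`), and `good ℓ` = a DEEP Zhang–Kolyvagin prime
(`Zhang2014.IsKolyvaginPrime … 2 ℓ ∧ L ≤ kolyvaginIndex W 2 ℓ ∧ FrobEqFrobInfty W K (2^L) ℓ`, the output currency of gk2-p4's pair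
Čebotarev `exists_deep_kolyvaginPrime_fullOrder_pair_of_data`).  THIS FILE performs that instantiation once, with the FORMAL binders
discharged in the tree — `hV` (`2^L` kills `H¹(K,E[2^L])`), `Finite R` (`R := ⟨u, x⟩ ≤ Sel_{2^L}(E_K/K)`, finite), and **`hK`**
(this seat's `relIndex_iInf_torsionLocalKer_closure_dvd_two_of_isKolyvaginPrime_natCast`, `…RTEigenIndexTwoKolyvaginPrime`, on the
`ε`-eigen Selmer subgroup `⟨u, x⟩`) — so that the KS integrator supplies ONLY Kolyvagin's data: the invariant `Inv` on `r`-sets of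
primes with a start `S₀` (attainment of the minimum `M_r`, LEAD `exists_kolyvaginMinima`), the ladder class `cls S` with its exponent
`e S` and own-prime vanishing (`hcls`: gk2-p2 `addOrderOf_zsmul_kolyvaginClass_two`, `zsmul_kolyvaginClass_two_mem_torsionLocalKer_of_forall`),
and the ORACLE (`weakSwapOracle_of_twoPrimeReciprocity` from `hceb` = gk2-p4 p712967 and `hrec` = gk2-p3 g23's lane).

* `exists_level_avoiding_finset_eigenSelmer_of_oracle` — core form: any finite set `s` of `ε`-eigen Selmer classes with `#s ≤ r`.
* `exists_level_avoiding_eigenSelmer_of_oracle` — the odd-depth KS clause shape: `u : Fin i → H¹`, `i ≤ r`, conclusion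
  `Disjoint ⟨cls S⟩ ⟨u⟩`.
* `exists_level_avoiding_eigenSelmer_sup_zmultiples_of_oracle` — the even-depth shape with the seed: `i + 1 ≤ r`, conclusion
  `Disjoint ⟨cls S⟩ (⟨u⟩ ⊔ ⟨x⟩)`.
* §2 primed variants `…_of_oracle'` — the same with `good` an ABSTRACT predicate only required to imply «Zhang–Kolyvagin ∧
  FrobEqFrobInfty (2^L)» (so the integrator may take the loop's primes deeper than `L`).

HONEST FRAMING.  THEOREMS ONLY (no definition, no named fact, no `sorry`); `Inv`, `cls`, `e`, `S₀`, `hcls`, `oracle` stay displayed;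
nothing here touches the skeleton or the stubs NPh/KS/Deep/P; the crux, stub KS and BSD are NOT proved by any of this.

References: [McCallumLMS1991] §5 Prop. 5.2 (proof, pp. 308–310), §4 Lemma 4.6; [Kolyvagin1991MathAnn] Thm. 2.1.
-/

set_option autoImplicit false
-- `Summit.<P>.<Sub>` repeats `BirchSwinnertonDyer` by the tree's layout convention (D-0017)
set_option linter.dupNamespace false

noncomputable section

open scoped Classical

namespace Summit.BirchSwinnertonDyer.BirchSwinnertonDyer.Theorems.GenusExact.PlusDescent

open WeierstrassCurve NumberField IsDedekindDomain Field
open Literature.NumberTheory.GaloisRepresentations Literature.NumberTheory.EllipticCurves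

variable (W : WeierstrassCurve ℚ) [W.IsElliptic] [W.IsGloballyMinimal] {K : Type} [Field K] [NumberField K]

/-- **The weak prime-swapping loop at `p = 2` over `K` on `τ`-EIGEN SELMER classes — core form.**  Frame: `W/ℚ` elliptic with
`Δ < 0`, `K` imaginary quadratic with non-trivial automorphism `τ`, a level `L ≥ 1`, a sign `ε = ±1`.  Loop data over prime labels
(DISPLAYED, to be supplied by the KS integrator from Kolyvagin's minima): a size `r`, an invariant `Inv` on `r`-sets with a start `S₀`,
a ladder class `cls S ∈ H¹(K, E[2^L])` of order `2^{e S}` (`e S ≥ 1`) lying in the strict condition `⨅_{v∋l} torsionLocalKer_v` at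
every own prime `l ∈ S`, for admissible all-deep `S`, and the ORACLE (a deep Zhang–Kolyvagin prime `l' ∉ S` swapping for any
`l₀ ∈ S` inside `Inv` and detecting the socle `2^{e S−1} cls S`).  THEN every finite set `s` of SELMER classes with `τ_* c = ε c` and
`#s ≤ r` is avoided: some admissible all-deep `S` has `⟨cls S⟩ ∩ ⟨s⟩ = 0`.  This is `exists_level_avoiding_of_weakSwapOracle_pow`
(p711486) with `V = H¹(K,E[2^L])`, `R = ⟨s⟩` (finite: inside `Sel_{2^L}(E_K/K)`), `A l = ⨅_{v∋l} torsionLocalKer_v`,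
`good l = «Zhang–Kolyvagin ∧ L ≤ index ∧ FrobEqFrobInfty W K (2^L) l»`, and `hK` = `relIndex_iInf_torsionLocalKer_closure_dvd_two_of_isKolyvaginPrime_natCast`.
[cite: McCallumLMS1991, §5 Prop. 5.2 (proof, pp. 308–310)] [cite: Kolyvagin1991MathAnn, Thm. 2.1] -/
theorem exists_level_avoiding_finset_eigenSelmer_of_oracle (hΔ : W.Δ < 0) (hK : IsImaginaryQuadratic K)
    {τ : K ≃ₐ[ℚ] K} (hτ : τ ≠ 1) {L : ℕ} (hL : 1 ≤ L) {ε : ℤ} (hε : ε = 1 ∨ ε = -1)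
    (r : ℕ) (Inv : Finset ℕ → Prop) (hcardS : ∀ S, Inv S → S.card = r) (S₀ : Finset ℕ) (hS₀ : Inv S₀)
    (cls : Finset ℕ → galH1Torsion (W.baseChange K) ((2 ^ L : ℕ) : ℤ)) (e : Finset ℕ → ℕ)
    (hcls : ∀ S, Inv S →
      (∀ l ∈ S, Zhang2014.IsKolyvaginPrime (W.conductorNorm ℤ) W K 2 l ∧ L ≤ Zhang2014.kolyvaginIndex W 2 l ∧
        FrobEqFrobInfty W K (2 ^ L) l) →
      addOrderOf (cls S) = 2 ^ e S ∧ 1 ≤ e S ∧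
        ∀ l ∈ S, cls S ∈ ⨅ (v : HeightOneSpectrum (𝓞 K)) (_ : (l : 𝓞 K) ∈ v.asIdeal),
          (W.baseChange K).torsionLocalKer (v.adicCompletion K) ((2 ^ L : ℕ) : ℤ))
    (oracle : ∀ S, Inv S → ∀ l₀ ∈ S, ∃ l', l' ∉ S ∧
      (Zhang2014.IsKolyvaginPrime (W.conductorNorm ℤ) W K 2 l' ∧ L ≤ Zhang2014.kolyvaginIndex W 2 l' ∧
        FrobEqFrobInfty W K (2 ^ L) l') ∧
      Inv (insert l' (S.erase l₀)) ∧
      2 ^ (e S - 1) • cls S ∉ ⨅ (v : HeightOneSpectrum (𝓞 K)) (_ : (l' : 𝓞 K) ∈ v.asIdeal),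
        (W.baseChange K).torsionLocalKer (v.adicCompletion K) ((2 ^ L : ℕ) : ℤ))
    (s : Finset (galH1Torsion (W.baseChange K) ((2 ^ L : ℕ) : ℤ)))
    (hsel : ∀ c ∈ s, c ∈ selmerGroup (W.baseChange K) ((2 ^ L : ℕ) : ℤ) ∧ conjAct W τ ((2 ^ L : ℕ) : ℤ) c = ε • c)
    (hsr : s.card ≤ r) :
    ∃ S, Inv S ∧
      (∀ l ∈ S, Zhang2014.IsKolyvaginPrime (W.conductorNorm ℤ) W K 2 l ∧ L ≤ Zhang2014.kolyvaginIndex W 2 l ∧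
        FrobEqFrobInfty W K (2 ^ L) l) ∧
      Disjoint (AddSubgroup.zmultiples (cls S))
        (AddSubgroup.closure (↑s : Set (galH1Torsion (W.baseChange K) ((2 ^ L : ℕ) : ℤ)))) := by
  haveI : (W.baseChange K).IsElliptic := by rw [baseChange]; infer_instance
  have hn0 : ((2 ^ L : ℕ) : ℤ) ≠ 0 := by exact_mod_cast pow_ne_zero L two_ne_zero
  -- the ambient: `R := ⟨s⟩`, a subgroup of `ε`-eigen Selmer classes, finite inside `Sel_{2^L}(E_K/K)`
  set R : AddSubgroup (galH1Torsion (W.baseChange K) ((2 ^ L : ℕ) : ℤ)) :=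
    AddSubgroup.closure (↑s : Set (galH1Torsion (W.baseChange K) ((2 ^ L : ℕ) : ℤ))) with hRdef
  have hR : ∀ c ∈ R, c ∈ selmerGroup (W.baseChange K) ((2 ^ L : ℕ) : ℤ) ∧ conjAct W τ ((2 ^ L : ℕ) : ℤ) c = ε • c :=
    forall_mem_closure_selmer_and_conjAct_eq W τ _ ε fun t ht ↦ hsel t ht
  have hRle : R ≤ selmerGroup (W.baseChange K) ((2 ^ L : ℕ) : ℤ) := fun c hc ↦ (hR c hc).1
  haveI : Finite (selmerGroup (W.baseChange K) ((2 ^ L : ℕ) : ℤ)) := (W.baseChange K).finite_selmerGroup_holds hn0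
  haveI : Finite R := Finite.of_injective _ (AddSubgroup.inclusion_injective hRle)
  -- `2^L` kills `H¹(K, E[2^L])`
  have hV : ∀ v : galH1Torsion (W.baseChange K) ((2 ^ L : ℕ) : ℤ), 2 ^ L • v = 0 := fun v ↦ by
    rw [← natCast_zsmul]
    exact zsmul_galH1Torsion_eq_zero _ _ v
  -- the loop
  exact exists_level_avoiding_of_weakSwapOracle_pow Nat.prime_two hV R
    (fun l ↦ ⨅ (v : HeightOneSpectrum (𝓞 K)) (_ : (l : 𝓞 K) ∈ v.asIdeal),
      (W.baseChange K).torsionLocalKer (v.adicCompletion K) ((2 ^ L : ℕ) : ℤ))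
    (fun l ↦ Zhang2014.IsKolyvaginPrime (W.conductorNorm ℤ) W K 2 l ∧ L ≤ Zhang2014.kolyvaginIndex W 2 l ∧
      FrobEqFrobInfty W K (2 ^ L) l)
    r Inv hcardS
    (fun l hl s' hs' ↦ relIndex_iInf_torsionLocalKer_closure_dvd_two_of_isKolyvaginPrime_natCast W hΔ hK hτ hL hl.1 hl.2.2 hε R
      hR s' hs')
    S₀ hS₀ cls e hcls oracle s AddSubgroup.subset_closure hsr

/-- **The loop for the ODD-depth KS clause**: the `≤ r` given SELMER `ε`-eigenclasses `u : Fin i → H¹(K, E[2^L])` (`i ≤ r`) are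
avoided by the ladder class of some admissible all-deep `S`: `⟨cls S⟩ ∩ ⟨u⟩ = 0` (the `Disjoint (zmultiples …) (closure (range u))`
shape of stub KS, up to the integrator's reading of `cls S` as `2^{L−M_{r−1}}•c_L(d_S)`). [cite: McCallumLMS1991, §5 Prop. 5.2] -/
theorem exists_level_avoiding_eigenSelmer_of_oracle (hΔ : W.Δ < 0) (hK : IsImaginaryQuadratic K)
    {τ : K ≃ₐ[ℚ] K} (hτ : τ ≠ 1) {L : ℕ} (hL : 1 ≤ L) {ε : ℤ} (hε : ε = 1 ∨ ε = -1)
    (r : ℕ) (Inv : Finset ℕ → Prop) (hcardS : ∀ S, Inv S → S.card = r) (S₀ : Finset ℕ) (hS₀ : Inv S₀)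
    (cls : Finset ℕ → galH1Torsion (W.baseChange K) ((2 ^ L : ℕ) : ℤ)) (e : Finset ℕ → ℕ)
    (hcls : ∀ S, Inv S →
      (∀ l ∈ S, Zhang2014.IsKolyvaginPrime (W.conductorNorm ℤ) W K 2 l ∧ L ≤ Zhang2014.kolyvaginIndex W 2 l ∧
        FrobEqFrobInfty W K (2 ^ L) l) →
      addOrderOf (cls S) = 2 ^ e S ∧ 1 ≤ e S ∧
        ∀ l ∈ S, cls S ∈ ⨅ (v : HeightOneSpectrum (𝓞 K)) (_ : (l : 𝓞 K) ∈ v.asIdeal),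
          (W.baseChange K).torsionLocalKer (v.adicCompletion K) ((2 ^ L : ℕ) : ℤ))
    (oracle : ∀ S, Inv S → ∀ l₀ ∈ S, ∃ l', l' ∉ S ∧
      (Zhang2014.IsKolyvaginPrime (W.conductorNorm ℤ) W K 2 l' ∧ L ≤ Zhang2014.kolyvaginIndex W 2 l' ∧
        FrobEqFrobInfty W K (2 ^ L) l') ∧
      Inv (insert l' (S.erase l₀)) ∧
      2 ^ (e S - 1) • cls S ∉ ⨅ (v : HeightOneSpectrum (𝓞 K)) (_ : (l' : 𝓞 K) ∈ v.asIdeal),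
        (W.baseChange K).torsionLocalKer (v.adicCompletion K) ((2 ^ L : ℕ) : ℤ))
    {i : ℕ} (u : Fin i → galH1Torsion (W.baseChange K) ((2 ^ L : ℕ) : ℤ))
    (hu : ∀ j, u j ∈ selmerGroup (W.baseChange K) ((2 ^ L : ℕ) : ℤ) ∧ conjAct W τ ((2 ^ L : ℕ) : ℤ) (u j) = ε • u j)
    (hir : i ≤ r) :
    ∃ S, Inv S ∧
      (∀ l ∈ S, Zhang2014.IsKolyvaginPrime (W.conductorNorm ℤ) W K 2 l ∧ L ≤ Zhang2014.kolyvaginIndex W 2 l ∧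
        FrobEqFrobInfty W K (2 ^ L) l) ∧
      Disjoint (AddSubgroup.zmultiples (cls S)) (AddSubgroup.closure (Set.range u)) := by
  set s : Finset (galH1Torsion (W.baseChange K) ((2 ^ L : ℕ) : ℤ)) := Finset.univ.image u with hsdef
  have hcoe : (↑s : Set (galH1Torsion (W.baseChange K) ((2 ^ L : ℕ) : ℤ))) = Set.range u := by
    rw [hsdef, Finset.coe_image, Finset.coe_univ, Set.image_univ]
  have hsel : ∀ c ∈ s, c ∈ selmerGroup (W.baseChange K) ((2 ^ L : ℕ) : ℤ) ∧ conjAct W τ ((2 ^ L : ℕ) : ℤ) c = ε • c := by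
    intro c hc
    obtain ⟨j, -, rfl⟩ := Finset.mem_image.mp hc
    exact hu j
  have hsr : s.card ≤ r := (Finset.card_image_le.trans (by rw [Finset.card_univ, Fintype.card_fin])).trans hir
  rw [← hcoe]
  exact exists_level_avoiding_finset_eigenSelmer_of_oracle W hΔ hK hτ hL hε r Inv hcardS S₀ hS₀ cls e hcls oracle s hsel hsr

/-- **The loop for the EVEN-depth KS clause (with the seed)**: the `≤ r − 1` given SELMER `ε`-eigenclasses `u : Fin i → H¹(K, E[2^L])`
and one more SELMER `ε`-eigenclass `x` (`c_L(1) = d₁.kolyvaginClass 2 L`, whose sign `−w(E)` is the clause's `ε`; `i + 1 ≤ r`) are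
avoided: `⟨cls S⟩ ∩ (⟨u⟩ ⊔ ⟨x⟩) = 0` for some admissible all-deep `S`. [cite: McCallumLMS1991, §5 Prop. 5.2] -/
theorem exists_level_avoiding_eigenSelmer_sup_zmultiples_of_oracle (hΔ : W.Δ < 0) (hK : IsImaginaryQuadratic K)
    {τ : K ≃ₐ[ℚ] K} (hτ : τ ≠ 1) {L : ℕ} (hL : 1 ≤ L) {ε : ℤ} (hε : ε = 1 ∨ ε = -1)
    (r : ℕ) (Inv : Finset ℕ → Prop) (hcardS : ∀ S, Inv S → S.card = r) (S₀ : Finset ℕ) (hS₀ : Inv S₀)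
    (cls : Finset ℕ → galH1Torsion (W.baseChange K) ((2 ^ L : ℕ) : ℤ)) (e : Finset ℕ → ℕ)
    (hcls : ∀ S, Inv S →
      (∀ l ∈ S, Zhang2014.IsKolyvaginPrime (W.conductorNorm ℤ) W K 2 l ∧ L ≤ Zhang2014.kolyvaginIndex W 2 l ∧
        FrobEqFrobInfty W K (2 ^ L) l) →
      addOrderOf (cls S) = 2 ^ e S ∧ 1 ≤ e S ∧
        ∀ l ∈ S, cls S ∈ ⨅ (v : HeightOneSpectrum (𝓞 K)) (_ : (l : 𝓞 K) ∈ v.asIdeal),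
          (W.baseChange K).torsionLocalKer (v.adicCompletion K) ((2 ^ L : ℕ) : ℤ))
    (oracle : ∀ S, Inv S → ∀ l₀ ∈ S, ∃ l', l' ∉ S ∧
      (Zhang2014.IsKolyvaginPrime (W.conductorNorm ℤ) W K 2 l' ∧ L ≤ Zhang2014.kolyvaginIndex W 2 l' ∧
        FrobEqFrobInfty W K (2 ^ L) l') ∧
      Inv (insert l' (S.erase l₀)) ∧
      2 ^ (e S - 1) • cls S ∉ ⨅ (v : HeightOneSpectrum (𝓞 K)) (_ : (l' : 𝓞 K) ∈ v.asIdeal),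
        (W.baseChange K).torsionLocalKer (v.adicCompletion K) ((2 ^ L : ℕ) : ℤ))
    {i : ℕ} (u : Fin i → galH1Torsion (W.baseChange K) ((2 ^ L : ℕ) : ℤ))
    (hu : ∀ j, u j ∈ selmerGroup (W.baseChange K) ((2 ^ L : ℕ) : ℤ) ∧ conjAct W τ ((2 ^ L : ℕ) : ℤ) (u j) = ε • u j)
    (x : galH1Torsion (W.baseChange K) ((2 ^ L : ℕ) : ℤ))
    (hx : x ∈ selmerGroup (W.baseChange K) ((2 ^ L : ℕ) : ℤ) ∧ conjAct W τ ((2 ^ L : ℕ) : ℤ) x = ε • x)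
    (hir : i + 1 ≤ r) :
    ∃ S, Inv S ∧
      (∀ l ∈ S, Zhang2014.IsKolyvaginPrime (W.conductorNorm ℤ) W K 2 l ∧ L ≤ Zhang2014.kolyvaginIndex W 2 l ∧
        FrobEqFrobInfty W K (2 ^ L) l) ∧
      Disjoint (AddSubgroup.zmultiples (cls S)) (AddSubgroup.closure (Set.range u) ⊔ AddSubgroup.zmultiples x) := by
  set s : Finset (galH1Torsion (W.baseChange K) ((2 ^ L : ℕ) : ℤ)) := Finset.univ.image u ∪ {x} with hsdef
  have hcoe : (↑s : Set (galH1Torsion (W.baseChange K) ((2 ^ L : ℕ) : ℤ))) = Set.range u ∪ {x} := by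
    rw [hsdef, Finset.coe_union, Finset.coe_image, Finset.coe_univ, Set.image_univ, Finset.coe_singleton]
  have hsel : ∀ c ∈ s, c ∈ selmerGroup (W.baseChange K) ((2 ^ L : ℕ) : ℤ) ∧ conjAct W τ ((2 ^ L : ℕ) : ℤ) c = ε • c := by
    intro c hc
    rcases Finset.mem_union.mp hc with hc | hc
    · obtain ⟨j, -, rfl⟩ := Finset.mem_image.mp hc
      exact hu j
    · rw [Finset.mem_singleton.mp hc]; exact hx
  have hsr : s.card ≤ r := by
    refine (Finset.card_union_le _ _).trans ?_
    rw [Finset.card_singleton]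
    exact (Nat.add_le_add_right (Finset.card_image_le.trans (by rw [Finset.card_univ, Fintype.card_fin])) 1).trans hir
  have hC : AddSubgroup.closure (Set.range u) ⊔ AddSubgroup.zmultiples x =
      AddSubgroup.closure (↑s : Set (galH1Torsion (W.baseChange K) ((2 ^ L : ℕ) : ℤ))) := by
    rw [hcoe, AddSubgroup.closure_union, AddSubgroup.zmultiples_eq_closure]
  rw [hC]
  exact exists_level_avoiding_finset_eigenSelmer_of_oracle W hΔ hK hτ hL hε r Inv hcardS S₀ hS₀ cls e hcls oracle s hsel hsr

/-! ## §2 The same loop with an ABSTRACT `good` (any predicate implying «Zhang–Kolyvagin ∧ FrobEqFrobInfty (2^L)») -/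

/-- **The loop at `p = 2` on `τ`-eigen Selmer classes, `good` ABSTRACT.**  As `exists_level_avoiding_finset_eigenSelmer_of_oracle`, but the
predicate `good` on prime labels is a PARAMETER, only required to imply what `hK` needs (`Zhang2014.IsKolyvaginPrime … 2 l ∧
FrobEqFrobInfty W K (2^L) l`); so the KS integrator may take `good` DEEPER than `L` (e.g. `L + 1 ≤ kolyvaginIndex ∧ FrobEqFrobInfty (2^(L+1))`,
should the reciprocity `hrec` want (I7)-isotropy at index `≥ L + 1`) without touching this file. [cite: McCallumLMS1991, §5 Prop. 5.2 (proof)]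
[cite: Kolyvagin1991MathAnn, Thm. 2.1] -/
theorem exists_level_avoiding_finset_eigenSelmer_of_oracle' (hΔ : W.Δ < 0) (hK : IsImaginaryQuadratic K)
    {τ : K ≃ₐ[ℚ] K} (hτ : τ ≠ 1) {L : ℕ} (hL : 1 ≤ L) {ε : ℤ} (hε : ε = 1 ∨ ε = -1)
    (good : ℕ → Prop)
    (hgood : ∀ l, good l → Zhang2014.IsKolyvaginPrime (W.conductorNorm ℤ) W K 2 l ∧ FrobEqFrobInfty W K (2 ^ L) l)
    (r : ℕ) (Inv : Finset ℕ → Prop) (hcardS : ∀ S, Inv S → S.card = r) (S₀ : Finset ℕ) (hS₀ : Inv S₀)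
    (cls : Finset ℕ → galH1Torsion (W.baseChange K) ((2 ^ L : ℕ) : ℤ)) (e : Finset ℕ → ℕ)
    (hcls : ∀ S, Inv S → (∀ l ∈ S, good l) →
      addOrderOf (cls S) = 2 ^ e S ∧ 1 ≤ e S ∧
        ∀ l ∈ S, cls S ∈ ⨅ (v : HeightOneSpectrum (𝓞 K)) (_ : (l : 𝓞 K) ∈ v.asIdeal),
          (W.baseChange K).torsionLocalKer (v.adicCompletion K) ((2 ^ L : ℕ) : ℤ))
    (oracle : ∀ S, Inv S → ∀ l₀ ∈ S, ∃ l', l' ∉ S ∧ good l' ∧ Inv (insert l' (S.erase l₀)) ∧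
      2 ^ (e S - 1) • cls S ∉ ⨅ (v : HeightOneSpectrum (𝓞 K)) (_ : (l' : 𝓞 K) ∈ v.asIdeal),
        (W.baseChange K).torsionLocalKer (v.adicCompletion K) ((2 ^ L : ℕ) : ℤ))
    (s : Finset (galH1Torsion (W.baseChange K) ((2 ^ L : ℕ) : ℤ)))
    (hsel : ∀ c ∈ s, c ∈ selmerGroup (W.baseChange K) ((2 ^ L : ℕ) : ℤ) ∧ conjAct W τ ((2 ^ L : ℕ) : ℤ) c = ε • c)
    (hsr : s.card ≤ r) :
    ∃ S, Inv S ∧ (∀ l ∈ S, good l) ∧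
      Disjoint (AddSubgroup.zmultiples (cls S))
        (AddSubgroup.closure (↑s : Set (galH1Torsion (W.baseChange K) ((2 ^ L : ℕ) : ℤ)))) := by
  haveI : (W.baseChange K).IsElliptic := by rw [baseChange]; infer_instance
  have hn0 : ((2 ^ L : ℕ) : ℤ) ≠ 0 := by exact_mod_cast pow_ne_zero L two_ne_zero
  set R : AddSubgroup (galH1Torsion (W.baseChange K) ((2 ^ L : ℕ) : ℤ)) :=
    AddSubgroup.closure (↑s : Set (galH1Torsion (W.baseChange K) ((2 ^ L : ℕ) : ℤ))) with hRdef
  have hR : ∀ c ∈ R, c ∈ selmerGroup (W.baseChange K) ((2 ^ L : ℕ) : ℤ) ∧ conjAct W τ ((2 ^ L : ℕ) : ℤ) c = ε • c :=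
    forall_mem_closure_selmer_and_conjAct_eq W τ _ ε fun t ht ↦ hsel t ht
  have hRle : R ≤ selmerGroup (W.baseChange K) ((2 ^ L : ℕ) : ℤ) := fun c hc ↦ (hR c hc).1
  haveI : Finite (selmerGroup (W.baseChange K) ((2 ^ L : ℕ) : ℤ)) := (W.baseChange K).finite_selmerGroup_holds hn0
  haveI : Finite R := Finite.of_injective _ (AddSubgroup.inclusion_injective hRle)
  have hV : ∀ v : galH1Torsion (W.baseChange K) ((2 ^ L : ℕ) : ℤ), 2 ^ L • v = 0 := fun v ↦ by
    rw [← natCast_zsmul]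
    exact zsmul_galH1Torsion_eq_zero _ _ v
  exact exists_level_avoiding_of_weakSwapOracle_pow Nat.prime_two hV R
    (fun l ↦ ⨅ (v : HeightOneSpectrum (𝓞 K)) (_ : (l : 𝓞 K) ∈ v.asIdeal),
      (W.baseChange K).torsionLocalKer (v.adicCompletion K) ((2 ^ L : ℕ) : ℤ))
    good r Inv hcardS
    (fun l hl s' hs' ↦ relIndex_iInf_torsionLocalKer_closure_dvd_two_of_isKolyvaginPrime_natCast W hΔ hK hτ hL (hgood l hl).1
      (hgood l hl).2 hε R hR s' hs')
    S₀ hS₀ cls e hcls oracle s AddSubgroup.subset_closure hsr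

/-- **Even-depth KS shape with the seed, `good` abstract**: `u : Fin i → H¹` and `x` SELMER `ε`-eigenclasses, `i + 1 ≤ r` ⟹
`⟨cls S⟩ ∩ (⟨u⟩ ⊔ ⟨x⟩) = 0` for some admissible all-good `S` (the odd-depth shape is the case `s := image u` of the finset form).
[cite: McCallumLMS1991, §5 Prop. 5.2] -/
theorem exists_level_avoiding_eigenSelmer_sup_zmultiples_of_oracle' (hΔ : W.Δ < 0) (hK : IsImaginaryQuadratic K)
    {τ : K ≃ₐ[ℚ] K} (hτ : τ ≠ 1) {L : ℕ} (hL : 1 ≤ L) {ε : ℤ} (hε : ε = 1 ∨ ε = -1)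
    (good : ℕ → Prop)
    (hgood : ∀ l, good l → Zhang2014.IsKolyvaginPrime (W.conductorNorm ℤ) W K 2 l ∧ FrobEqFrobInfty W K (2 ^ L) l)
    (r : ℕ) (Inv : Finset ℕ → Prop) (hcardS : ∀ S, Inv S → S.card = r) (S₀ : Finset ℕ) (hS₀ : Inv S₀)
    (cls : Finset ℕ → galH1Torsion (W.baseChange K) ((2 ^ L : ℕ) : ℤ)) (e : Finset ℕ → ℕ)
    (hcls : ∀ S, Inv S → (∀ l ∈ S, good l) →
      addOrderOf (cls S) = 2 ^ e S ∧ 1 ≤ e S ∧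
        ∀ l ∈ S, cls S ∈ ⨅ (v : HeightOneSpectrum (𝓞 K)) (_ : (l : 𝓞 K) ∈ v.asIdeal),
          (W.baseChange K).torsionLocalKer (v.adicCompletion K) ((2 ^ L : ℕ) : ℤ))
    (oracle : ∀ S, Inv S → ∀ l₀ ∈ S, ∃ l', l' ∉ S ∧ good l' ∧ Inv (insert l' (S.erase l₀)) ∧
      2 ^ (e S - 1) • cls S ∉ ⨅ (v : HeightOneSpectrum (𝓞 K)) (_ : (l' : 𝓞 K) ∈ v.asIdeal),
        (W.baseChange K).torsionLocalKer (v.adicCompletion K) ((2 ^ L : ℕ) : ℤ))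
    {i : ℕ} (u : Fin i → galH1Torsion (W.baseChange K) ((2 ^ L : ℕ) : ℤ))
    (hu : ∀ j, u j ∈ selmerGroup (W.baseChange K) ((2 ^ L : ℕ) : ℤ) ∧ conjAct W τ ((2 ^ L : ℕ) : ℤ) (u j) = ε • u j)
    (x : galH1Torsion (W.baseChange K) ((2 ^ L : ℕ) : ℤ))
    (hx : x ∈ selmerGroup (W.baseChange K) ((2 ^ L : ℕ) : ℤ) ∧ conjAct W τ ((2 ^ L : ℕ) : ℤ) x = ε • x)
    (hir : i + 1 ≤ r) :
    ∃ S, Inv S ∧ (∀ l ∈ S, good l) ∧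
      Disjoint (AddSubgroup.zmultiples (cls S)) (AddSubgroup.closure (Set.range u) ⊔ AddSubgroup.zmultiples x) := by
  set s : Finset (galH1Torsion (W.baseChange K) ((2 ^ L : ℕ) : ℤ)) := Finset.univ.image u ∪ {x} with hsdef
  have hcoe : (↑s : Set (galH1Torsion (W.baseChange K) ((2 ^ L : ℕ) : ℤ))) = Set.range u ∪ {x} := by
    rw [hsdef, Finset.coe_union, Finset.coe_image, Finset.coe_univ, Set.image_univ, Finset.coe_singleton]
  have hsel : ∀ c ∈ s, c ∈ selmerGroup (W.baseChange K) ((2 ^ L : ℕ) : ℤ) ∧ conjAct W τ ((2 ^ L : ℕ) : ℤ) c = ε • c := by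
    intro c hc
    rcases Finset.mem_union.mp hc with hc | hc
    · obtain ⟨j, -, rfl⟩ := Finset.mem_image.mp hc
      exact hu j
    · rw [Finset.mem_singleton.mp hc]; exact hx
  have hsr : s.card ≤ r := by
    refine (Finset.card_union_le _ _).trans ?_
    rw [Finset.card_singleton]
    exact (Nat.add_le_add_right (Finset.card_image_le.trans (by rw [Finset.card_univ, Fintype.card_fin])) 1).trans hir
  have hC : AddSubgroup.closure (Set.range u) ⊔ AddSubgroup.zmultiples x =
      AddSubgroup.closure (↑s : Set (galH1Torsion (W.baseChange K) ((2 ^ L : ℕ) : ℤ))) := by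
    rw [hcoe, AddSubgroup.closure_union, AddSubgroup.zmultiples_eq_closure]
  rw [hC]
  exact exists_level_avoiding_finset_eigenSelmer_of_oracle' W hΔ hK hτ hL hε good hgood r Inv hcardS S₀ hS₀ cls e hcls oracle s
    hsel hsr

end Summit.BirchSwinnertonDyer.BirchSwinnertonDyer.Theorems.GenusExact.PlusDescent

end
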